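import Summits.BirchSwinnertonDyer.Rank1Residual.GaloisImage.KolyvaginLevelCounting
import HarnessLib

/-!
# Route `KimAtThreeKolyvagin` (rung W2), crux `DeepUpperAtThree`: the DUAL STEP `d ↦ d𝔮` of Rubin's
# Cor. 2.6.2 (2) at a GENERAL MODULUS — the first kernel piece of the STUB port beyond `m = 1`

Cell `bsd-addord`, seat `bsd-addord-w2-c3` (D-0074 row B6), item `stmt-BirchSwinnertonDyer-19076`.
TOOL theorems on Selmer structures of a finite discrete `Γ_K`-module killed by ANY `n` (read at
`n = 3^{k+1}` by the STUB port `hStub` of `KimAtThreeDeepUpperOfPorts.deepUpper_conclusion_of_ports`);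
no definition, no named fact, no `sorry`; nothing asserted about any curve.

WHY.  The STUB port of crux 19076 (Mazur–Rubin Thm. 4.3.4 / Rubin PCMI Thm. 2.8.4 at `p = 3`,
GENERAL `m`: `κ_n ∈ p^{λ(n,A^*)} H¹_{𝓕(n)}`) is in the tree only at `m = 1`
(`CoreRankZero.apply_eq_zero_of_dualSelmerGroup_atLevel_ne_bot`, n1011 `KolyvaginStubVanishing`).  Its
printed engine is Rubin's Prop. 2.6.1 / Cor. 2.6.2 (pp. 22–23, held: `paper:doi-10-1090-pcms-018-14`),
"stepping along the Selmer graph" at modulus `p^m`.  n1011's `KolyvaginLevelCounting` §7 types the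
`m = 1` case (`dualSelmerGroup_strictAt_eq`, `card_dualSelmerGroup_atLevel_insert_lt`: a class non-zero
at `𝔮` generates `H¹_ur(K_𝔮, M)` because it has PRIME order `p`).  At a general modulus the right
hypothesis is Rubin's: the localisation `H¹_{𝓕(d)}(K, M) → 𝓕_𝔮 = H¹_ur(K_𝔮, M)` is SURJECTIVE
(Cor. 2.6.2 (2)).  This file proves, for ANY `n`:
* `StubStep.dualSelmerGroup_strictAt_le_of_loc_surjective` — **Cor. 2.6.2 (2), first clause**: if
  `loc_𝔮 : H¹_{𝓕(d)} → 𝓕(d)_𝔮` is onto, then `H¹_{𝓕_𝔮(d)^*}(K, M^D) ≤ H¹_{𝓕(d)^*}(K, M^D)` (every dual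
  class with NO condition at `𝔮` is automatically orthogonal to `𝓕(d)_𝔮` there) — by Poitou–Tate's
  VANISHING `∑_v ⟨x_v, y_v⟩_v = 0` alone (the tree's
  `SumLocalTermEqZero.dualSelmerGroup_le_of_forall_exists` with the one-place set `{𝔮}`), no counting
  and no primality; hence equality `…_eq_of_loc_surjective`;
* `StubStep.dualSelmerGroup_atLevel_insert_le_of_loc_surjective` — **Cor. 2.6.2 (2), second clause**:
  then `H¹_{𝓕(d𝔮)^*} ≤ {y ∈ H¹_{𝓕(d)^*} : loc_𝔮 y = 0}` when `H¹(K_𝔮, M) = H¹_ur + 𝒯_𝔮` at `𝔮`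
  (`loc_𝔮 y ∈ (H¹_ur)^⊥ ∩ 𝒯_𝔮^⊥ = (H¹_ur ⊔ 𝒯_𝔮)^⊥ = 0` by perfectness);
* `StubStep.natCard_dualSelmerGroup_atLevel_insert_lt_of_loc_surjective` — and `#H¹_{𝓕(d𝔮)^*} <
  #H¹_{𝓕(d)^*}` as soon as some dual class is non-zero at `𝔮` (Cor. 2.6.2 (4), dual half, at modulus `n`).
[cite: Rubin2011, Prop. 2.6.1 and Cor. 2.6.2 (2)(4) (pp. 22–23)] [cite: MazurRubin2004, Lemma 4.1.7]
[cite: JetchevSkinnerWan2017, Prop. 3.2.1, proof (arXiv:1512.06894 p. 10)]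
-/

set_option autoImplicit false
-- the Theorems namespace of a single-conjunct summit repeats the summit name by design (D-0017)
set_option linter.dupNamespace false

noncomputable section

open scoped Classical NumberField ContRepresentation
open Function NumberField IsDedekindDomain
  Literature.NumberTheory.GaloisRepresentations
  Literature.NumberTheory.GaloisRepresentations.DiscreteGaloisModule Literature.NumberTheory.GaloisCohomology
  Summit.BirchSwinnertonDyer.Rank1Residual.GaloisImage
  Summit.BirchSwinnertonDyer.Rank1Residual.GaloisImage.CoreRankZero

universe u

namespace Summit.BirchSwinnertonDyer.BirchSwinnertonDyer.Theorems.KimAtThreeDeepUpperStubDualStep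

namespace StubStep

variable {K : Type u} [Field K] [NumberField K] {n : ℕ}
variable {M : Type u} [AddCommGroup M] [TopologicalSpace M] [DiscreteTopology M] [Finite M]
variable {ρ : DiscreteGaloisModule K M}

/-- **Rubin Cor. 2.6.2 (2) at modulus `n`, first clause.**  If the localisation
`H¹_{𝓕(d)}(K, M) → 𝓕(d)_𝔮` at a finite place `𝔮` is SURJECTIVE, then every class of
`H¹_{𝓕_𝔮(d)^*}(K, M^D)` (the dual structure of `𝓕(d)` made strict at `𝔮`: no condition at `𝔮`) lies in
`H¹_{𝓕(d)^*}(K, M^D)`: by the Poitou–Tate vanishing `∑_v ⟨x_v, y_v⟩_v = 0` its component at `𝔮` pairs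
to zero with `loc_𝔮 x` for every `x ∈ H¹_{𝓕(d)}`, i.e. with all of `𝓕(d)_𝔮`.
[cite: Rubin2011, Cor. 2.6.2 (2) (p. 22)] [cite: JetchevSkinnerWan2017, Prop. 3.2.1, proof] -/
theorem dualSelmerGroup_strictAt_le_of_loc_surjective [NeZero n] {inv : LocalInvariants K n}
    (hsum : inv.SumLocalTermEqZero) (hM : ∀ m : M, n • m = 0)
    (D : KolyvaginDatum ρ) (𝓕 : SelmerStructure ρ)
    (d : Finset (HeightOneSpectrum (𝓞 K))) (q : HeightOneSpectrum (𝓞 K))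
    (hsurj : ∀ g ∈ D.atLevel 𝓕 d (Sum.inr q), ∃ x ∈ (D.atLevel 𝓕 d).selmerGroup,
      galoisCohomology.localization ρ (Sum.inr q) 1 x = g) :
    (inv.dualSelmerStructure ρ ((D.atLevel 𝓕 d).strictAt {q})).selmerGroup ≤
      (inv.dualSelmerStructure ρ (D.atLevel 𝓕 d)).selmerGroup := by
  refine hsum.dualSelmerGroup_le_of_forall_exists ρ hM (S := {Sum.inr q})
    (𝓕 := (D.atLevel 𝓕 d).strictAt {q}) (𝓖 := D.atLevel 𝓕 d) (fun v hv => le_of_eq ?_) ?_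
  · have hv' : v ≠ Sum.inr q := fun h => hv (Finset.mem_singleton.mpr h)
    exact (Level.strictAt_apply_of_ne _ q hv').symm
  · intro v₀ hv₀ g hg
    obtain rfl : v₀ = Sum.inr q := Finset.mem_singleton.mp hv₀
    obtain ⟨x, hx, hxg⟩ := hsurj g hg
    refine ⟨x, hx, ?_, fun v hv hne => absurd (Finset.mem_singleton.mp hv) hne⟩
    rw [hxg, sub_self]
    exact zero_mem _

/-- **Rubin Cor. 2.6.2 (2) at modulus `n`, as an equality**: under the surjectivity of
`H¹_{𝓕(d)} → 𝓕(d)_𝔮`, `H¹_{𝓕_𝔮(d)^*}(K, M^D) = H¹_{𝓕(d)^*}(K, M^D)` (the reverse inclusion is the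
antitonicity of `𝓛 ↦ H¹_{𝓛^*}`).  The general-modulus form of n1011's `CoreRankZero.dualSelmerGroup_strictAt_eq`.
[cite: Rubin2011, Cor. 2.6.2 (2) (p. 22)] -/
theorem dualSelmerGroup_strictAt_eq_of_loc_surjective [NeZero n] {inv : LocalInvariants K n}
    (hsum : inv.SumLocalTermEqZero) (hM : ∀ m : M, n • m = 0)
    (D : KolyvaginDatum ρ) (𝓕 : SelmerStructure ρ)
    (d : Finset (HeightOneSpectrum (𝓞 K))) (q : HeightOneSpectrum (𝓞 K))
    (hsurj : ∀ g ∈ D.atLevel 𝓕 d (Sum.inr q), ∃ x ∈ (D.atLevel 𝓕 d).selmerGroup,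
      galoisCohomology.localization ρ (Sum.inr q) 1 x = g) :
    (inv.dualSelmerStructure ρ ((D.atLevel 𝓕 d).strictAt {q})).selmerGroup =
      (inv.dualSelmerStructure ρ (D.atLevel 𝓕 d)).selmerGroup := by
  refine le_antisymm (dualSelmerGroup_strictAt_le_of_loc_surjective hsum hM D 𝓕 d q hsurj) ?_
  refine LocalInvariants.selmerGroup_dualSelmerStructure_anti inv ρ fun v => ?_
  by_cases hv : v = Sum.inr q
  · subst hv
    rw [Level.strictAt_inr_self]
    exact bot_le
  · rw [Level.strictAt_apply_of_ne _ q hv]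

/-- **Rubin Cor. 2.6.2 (2) at modulus `n`, second clause (the dual step `d ↦ d𝔮`).**  With `𝓕`
unramified outside `S`, the datum's primes off `S`, the local shape `H¹(K_𝔮, M) = H¹_ur ⊔ 𝒯_𝔮` at the
primes of the datum, and a perfect family: if `loc_𝔮 : H¹_{𝓕(d)} → 𝓕_𝔮 = H¹_ur(K_𝔮, M)` is onto at a
prime `𝔮 ∈ 𝒫 ∖ d`, then `H¹_{𝓕(d𝔮)^*}(K, M^D) ≤ {y ∈ H¹_{𝓕(d)^*}(K, M^D) : loc_𝔮 y = 0}`.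
[cite: Rubin2011, Cor. 2.6.2 (2) (p. 22)] [cite: MazurRubin2004, Lemma 4.1.7] -/
theorem dualSelmerGroup_atLevel_insert_le_of_loc_surjective [NeZero n] {inv : LocalInvariants K n}
    (hperf : inv.IsPerfect) (hsum : inv.SumLocalTermEqZero) (hM : ∀ m : M, n • m = 0)
    {S : Finset (Place K)} {𝓕 : SelmerStructure ρ} (h𝓕 : 𝓕.IsUnramifiedOutside S)
    {D : KolyvaginDatum ρ} (hPS : ∀ q ∈ D.primes, (Sum.inr q : Place K) ∉ S)
    (hUT : ∀ q ∈ D.primes,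
      unramifiedSubgroup (GaloisRep.toLocal q ρ) 1 ⊔ D.transverse (Sum.inr q) = ⊤)
    (d : Finset (HeightOneSpectrum (𝓞 K))) {q : HeightOneSpectrum (𝓞 K)}
    (hq : q ∈ D.primes) (hqd : q ∉ d)
    (hsurj : ∀ g ∈ D.atLevel 𝓕 d (Sum.inr q), ∃ x ∈ (D.atLevel 𝓕 d).selmerGroup,
      galoisCohomology.localization ρ (Sum.inr q) 1 x = g) :
    (inv.dualSelmerStructure ρ (D.atLevel 𝓕 (insert q d))).selmerGroup ≤
      (inv.dualSelmerStructure ρ (D.atLevel 𝓕 d)).selmerGroup ⊓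
        (galoisCohomology.localization (ρ.tateDual n) (Sum.inr q) 1).ker := by
  haveI := DiscreteGaloisModule.TateDual.finite K M n
  have hEq := dualSelmerGroup_strictAt_eq_of_loc_surjective hsum hM D 𝓕 d q hsurj
  have hUT' : (max (unramifiedSubgroup (GaloisRep.toLocal q ρ) 1) (D.transverse (Sum.inr q)) :
      AddSubgroup (galoisCohomology (ρ.toLocal (Sum.inr q)) 1)) = ⊤ := hUT q hq
  intro z hz
  -- `z` lies in `H¹_{𝓕_𝔮(d)^*}` (no condition at `𝔮`), hence in `H¹_{𝓕(d)^*}`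
  have hzA : z ∈ (inv.dualSelmerStructure ρ ((D.atLevel 𝓕 d).strictAt {q})).selmerGroup := by
    refine mem_selmerGroup_of_forall_ne q (fun v hv => le_of_eq ?_) hz ?_
    · rw [LocalInvariants.dualSelmerStructure_apply, LocalInvariants.dualSelmerStructure_apply,
        Level.atLevel_insert_apply_of_ne D 𝓕 q hv, Level.strictAt_apply_of_ne _ q hv]
    · rw [LocalInvariants.dualSelmerStructure_apply, Level.strictAt_inr_self,
        LocalInvariants.dualLocalCondition_bot]
      exact AddSubgroup.mem_top _
  rw [hEq] at hzA
  refine ⟨hzA, (AddMonoidHom.mem_ker).2 ?_⟩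
  -- at `𝔮`: `loc_𝔮 z ∈ (H¹_ur)^⊥ ⊓ 𝒯_𝔮^⊥ = (H¹_ur ⊔ 𝒯_𝔮)^⊥ = 0`
  have h1 := (SelmerStructure.mem_selmerGroup_iff _ _).1 hzA (Sum.inr q)
  rw [LocalInvariants.dualSelmerStructure_apply, Level.atLevel_inr_of_not_mem D 𝓕 hqd,
    h𝓕.2 q (hPS q hq)] at h1
  have h2 := (SelmerStructure.mem_selmerGroup_iff _ _).1 hz (Sum.inr q)
  rw [LocalInvariants.dualSelmerStructure_apply, Level.atLevel_insert_inr_self] at h2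
  have h12 : galoisCohomology.localization (ρ.tateDual n) (Sum.inr q) 1 z ∈
      inv.dualLocalCondition ρ (Sum.inr q) (unramifiedSubgroup (GaloisRep.toLocal q ρ) 1) ⊓
        inv.dualLocalCondition ρ (Sum.inr q) (D.transverse (Sum.inr q)) :=
    AddSubgroup.mem_inf.2 ⟨h1, h2⟩
  rw [← dualLocalCondition_sup, hUT', dualLocalCondition_top_of_isPerfect hperf ρ hM q,
    AddSubgroup.mem_bot] at h12
  exact h12

/-- **The dual Selmer group drops from `d` to `d𝔮` at modulus `n`** (Rubin Cor. 2.6.2 (4), dual half,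
with the general-modulus hypothesis): if `loc_𝔮 : H¹_{𝓕(d)} → H¹_ur(K_𝔮, M)` is onto and some class of
`H¹_{𝓕(d)^*}(K, M^D)` is non-zero at `𝔮`, then `#H¹_{𝓕(d𝔮)^*}(K, M^D) < #H¹_{𝓕(d)^*}(K, M^D)`.
[cite: Rubin2011, Cor. 2.6.2 (2) and (4) (pp. 22–23)] -/
theorem natCard_dualSelmerGroup_atLevel_insert_lt_of_loc_surjective [NeZero n]
    {inv : LocalInvariants K n}
    (hperf : inv.IsPerfect) (hsum : inv.SumLocalTermEqZero) (hM : ∀ m : M, n • m = 0)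
    {S : Finset (Place K)} {𝓕 : SelmerStructure ρ} (h𝓕 : 𝓕.IsUnramifiedOutside S)
    (hfind : Finite (inv.dualSelmerStructure ρ 𝓕).selmerGroup)
    {D : KolyvaginDatum ρ} (hPS : ∀ q ∈ D.primes, (Sum.inr q : Place K) ∉ S)
    (hUT : ∀ q ∈ D.primes,
      unramifiedSubgroup (GaloisRep.toLocal q ρ) 1 ⊔ D.transverse (Sum.inr q) = ⊤)
    (d : Finset (HeightOneSpectrum (𝓞 K))) {q : HeightOneSpectrum (𝓞 K)}
    (hq : q ∈ D.primes) (hqd : q ∉ d)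
    (hsurj : ∀ g ∈ D.atLevel 𝓕 d (Sum.inr q), ∃ x ∈ (D.atLevel 𝓕 d).selmerGroup,
      galoisCohomology.localization ρ (Sum.inr q) 1 x = g)
    {y : galoisCohomology (ρ.tateDual n) 1}
    (hy : y ∈ (inv.dualSelmerStructure ρ (D.atLevel 𝓕 d)).selmerGroup)
    (hyq : galoisCohomology.localization (ρ.tateDual n) (Sum.inr q) 1 y ≠ 0) :
    Nat.card (inv.dualSelmerStructure ρ (D.atLevel 𝓕 (insert q d))).selmerGroup <
      Nat.card (inv.dualSelmerStructure ρ (D.atLevel 𝓕 d)).selmerGroup := by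
  haveI := DiscreteGaloisModule.TateDual.finite K M n
  haveI hfBd := finite_dualSelmerGroup_atLevel inv D 𝓕 hfind d
  have hCZ := dualSelmerGroup_atLevel_insert_le_of_loc_surjective hperf hsum hM h𝓕 hPS hUT d hq hqd hsurj
  set Z : AddSubgroup (galoisCohomology (ρ.tateDual n) 1) :=
    (inv.dualSelmerStructure ρ (D.atLevel 𝓕 d)).selmerGroup ⊓
      (galoisCohomology.localization (ρ.tateDual n) (Sum.inr q) 1).ker with hZ
  have hZle : Z ≤ (inv.dualSelmerStructure ρ (D.atLevel 𝓕 d)).selmerGroup := inf_le_left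
  haveI : Finite Z := Finite.of_injective _ (AddSubgroup.inclusion_injective hZle)
  have hyZ : y ∉ Z := fun h => hyq ((AddMonoidHom.mem_ker).1 h.2)
  have hZlt : Nat.card Z < Nat.card (inv.dualSelmerStructure ρ (D.atLevel 𝓕 d)).selmerGroup := by
    refine lt_of_le_of_ne (AddSubgroup.card_le_of_le hZle) fun h => hyZ ?_
    rw [AddSubgroup.eq_of_le_of_card_ge hZle h.ge]
    exact hy
  exact lt_of_le_of_lt (AddSubgroup.card_le_of_le hCZ) hZlt

end StubStep

end Summit.BirchSwinnertonDyer.BirchSwinnertonDyer.Theorems.KimAtThreeDeepUpperStubDualStep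

end
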